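import Mathlib.Topology.ContinuousMap.Compact
import Mathlib.Topology.UnitInterval
import Mathlib.Topology.Order.MonotoneContinuity
import Mathlib.Topology.MetricSpace.Basic
import Mathlib.Topology.Connected.PathConnected
import Mathlib.MeasureTheory.Constructions.BorelSpace.Basic
import HarnessLib

-- provenance: harness21/H21/H21/Prelude/Stoch/Curve.lean @ 399d27b (interim HEAD d8f2665); M5 mechanical rewrite
/-!
# Parametrised curves and the reparametrisation pseudo-metric

Trunk `Stoch`, prelude item `Curve` (notion `curve_space_mod_reparam`, part 1).

A *curve* in a topological space `E` is a continuous map `unitInterval → E`. Two curves are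
identified (in the follow-up file `CurveSpace`) when they differ by an increasing reparametrisation
of `[0,1]`; the corresponding pseudo-distance is
`reparamDist γ₁ γ₂ = inf_φ sup_t dist (γ₁ t) (γ₂ (φ t))`, the infimum over increasing
self-homeomorphisms `φ` of `[0,1]`.

Source: M. Aizenman, A. Burchard, *Hölder regularity and dimension bounds for random curves*,
Duke Math. J. 99 (1999), §2.1 (the space of curves modulo reparametrisation).

## Design

* `Curve E` is a one-field structure wrapping `C(unitInterval, E)`, so that the sup metric of
  `C(unitInterval, E)` (Mathlib's `ContinuousMap` metric on a compact domain) does not become the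
  metric on curves. The pseudo-metric on `Curve E` is the reparametrisation distance, and the
  instance `Curve.instPseudoMetricSpace` is fully proved.
* Increasing reparametrisations are Mathlib's `unitInterval ≃o unitInterval`; continuity comes from
  `OrderIso.toHomeomorph` (order topology on `unitInterval`).
* Mathlib has `Path x y` (curves with fixed endpoints, sup topology) but no endpoint-free curve
  type with the reparametrisation metric; `Curve.ofPath` converts.
* The Borel σ-algebra of the pseudo-metric topology is registered.
-/

open Set Filter Topology

namespace Literature.Probability.RandomPlanarGeometry

/-- A parametrised curve in a topological space `E`: a continuous map from `unitInterval`.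
This is a one-field structure so that the sup metric of `C(unitInterval, E)` does not become an
instance on curves; curves instead carry the reparametrisation pseudo-metric
(Aizenman–Burchard, Duke Math. J. 99 (1999), §2.1). [folklore] -/
@[ext]
structure Curve (E : Type*) [TopologicalSpace E] where
  /-- The underlying continuous map `unitInterval → E`. -/
  toContinuousMap : C(unitInterval, E)

namespace Curve

variable {E F : Type*}

section Topological

variable [TopologicalSpace E] [TopologicalSpace F]

/-- Curves are functions `unitInterval → E` (Aizenman–Burchard 1999, §2.1). [cite: AizenmanBurchard1999, §2.1] -/
instance instFunLike : FunLike (Curve E) unitInterval E where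
  coe γ := γ.toContinuousMap
  coe_injective γ₁ γ₂ h := by
    cases γ₁; cases γ₂; congr; exact DFunLike.coe_injective h

/-- The coercion of the underlying continuous map is the coercion of the curve
(Aizenman–Burchard 1999, §2.1). [cite: AizenmanBurchard1999, §2.1] -/
@[simp] lemma coe_toContinuousMap (γ : Curve E) : ⇑γ.toContinuousMap = γ := rfl

/-- The underlying map of a curve is continuous (Aizenman–Burchard 1999, §2.1). [cite: AizenmanBurchard1999, §2.1] -/
protected lemma continuous (γ : Curve E) : Continuous γ := γ.toContinuousMap.continuous

/-- An increasing self-homeomorphism of `unitInterval` (an order automorphism), bundled as a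
continuous map; continuity is `OrderIso.toHomeomorph` for the order topology of `unitInterval`
(Aizenman–Burchard 1999, §2.1: admissible reparametrisations). Deliberate dot-notation extension
of Mathlib's `OrderIso` namespace. [cite: AizenmanBurchard1999, §2.1: admissible reparametrisations] -/
def _root_.OrderIso.toContinuousMapUnitInterval (φ : unitInterval ≃o unitInterval) :
    C(unitInterval, unitInterval) :=
  ⟨φ, φ.toHomeomorph.continuous⟩

/-- Pointwise formula for `OrderIso.toContinuousMapUnitInterval` (Aizenman–Burchard 1999, §2.1). [cite: AizenmanBurchard1999, §2.1] -/
@[simp] lemma _root_.OrderIso.toContinuousMapUnitInterval_apply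
    (φ : unitInterval ≃o unitInterval) (t : unitInterval) :
    φ.toContinuousMapUnitInterval t = φ t := rfl

/-- Reparametrise a curve by an increasing homeomorphism `φ` of the parameter interval:
`(γ.reparam φ) t = γ (φ t)` (Aizenman–Burchard 1999, §2.1). [cite: AizenmanBurchard1999, §2.1] -/
def reparam (γ : Curve E) (φ : unitInterval ≃o unitInterval) : Curve E :=
  ⟨γ.toContinuousMap.comp φ.toContinuousMapUnitInterval⟩

/-- Pointwise formula for reparametrisation (Aizenman–Burchard 1999, §2.1). [cite: AizenmanBurchard1999, §2.1] -/
@[simp] lemma reparam_apply (γ : Curve E) (φ : unitInterval ≃o unitInterval) (t : unitInterval) :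
    γ.reparam φ t = γ (φ t) := rfl

/-- Reparametrising by the identity does nothing (Aizenman–Burchard 1999, §2.1). [cite: AizenmanBurchard1999, §2.1] -/
@[simp] lemma reparam_refl (γ : Curve E) : γ.reparam (OrderIso.refl _) = γ := by
  ext t; rfl

/-- Iterated reparametrisation is reparametrisation by the composite
(Aizenman–Burchard 1999, §2.1). [cite: AizenmanBurchard1999, §2.1] -/
lemma reparam_reparam (γ : Curve E) (φ ψ : unitInterval ≃o unitInterval) :
    (γ.reparam φ).reparam ψ = γ.reparam (ψ.trans φ) := by
  ext t; rfl

/-- The group of increasing reparametrisations of `[0,1]` is nonempty (it contains the identity);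
needed for `ciInf` over it (Aizenman–Burchard 1999, §2.1). [cite: AizenmanBurchard1999, §2.1] -/
instance : Nonempty (unitInterval ≃o unitInterval) := ⟨OrderIso.refl _⟩

/-- The starting point `γ 0` of a curve (Aizenman–Burchard 1999, §2.1). [cite: AizenmanBurchard1999, §2.1] -/
def source (γ : Curve E) : E := γ 0

/-- The end point `γ 1` of a curve (Aizenman–Burchard 1999, §2.1). [cite: AizenmanBurchard1999, §2.1] -/
def target (γ : Curve E) : E := γ 1

/-- The trace (image) of a curve in `E` (Aizenman–Burchard 1999, §2.1). [cite: AizenmanBurchard1999, §2.1] -/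
protected def range (γ : Curve E) : Set E := Set.range γ

/-- Unfolding `Curve.source` (Aizenman–Burchard 1999, §2.1). [cite: AizenmanBurchard1999, §2.1] -/
lemma source_def (γ : Curve E) : γ.source = γ 0 := rfl

/-- Unfolding `Curve.target` (Aizenman–Burchard 1999, §2.1). [cite: AizenmanBurchard1999, §2.1] -/
lemma target_def (γ : Curve E) : γ.target = γ 1 := rfl

/-- Membership in the trace of a curve (Aizenman–Burchard 1999, §2.1). [cite: AizenmanBurchard1999, §2.1] -/
lemma mem_range {γ : Curve E} {x : E} : x ∈ γ.range ↔ ∃ t, γ t = x := Iff.rfl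

/-- Increasing reparametrisations fix the starting point (an order isomorphism of `[0,1]`
fixes `0`; Aizenman–Burchard 1999, §2.1). [cite: AizenmanBurchard1999, §2.1] -/
@[simp] lemma source_reparam (γ : Curve E) (φ : unitInterval ≃o unitInterval) :
    (γ.reparam φ).source = γ.source := by
  simp [source, show (0 : unitInterval) = ⊥ from rfl]

/-- Increasing reparametrisations fix the end point (an order isomorphism of `[0,1]`
fixes `1`; Aizenman–Burchard 1999, §2.1). [cite: AizenmanBurchard1999, §2.1] -/
@[simp] lemma target_reparam (γ : Curve E) (φ : unitInterval ≃o unitInterval) :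
    (γ.reparam φ).target = γ.target := by
  simp [target, show (1 : unitInterval) = ⊤ from rfl]

/-- Reparametrisation does not change the trace of a curve (Aizenman–Burchard 1999, §2.1). [cite: AizenmanBurchard1999, §2.1] -/
@[simp] lemma range_reparam (γ : Curve E) (φ : unitInterval ≃o unitInterval) :
    (γ.reparam φ).range = γ.range := by
  change Set.range (γ ∘ φ) = Set.range γ
  exact φ.surjective.range_comp γ

/-- The trace of a curve is compact (continuous image of `[0,1]`;
Aizenman–Burchard 1999, §2.1). [cite: AizenmanBurchard1999, §2.1] -/
lemma isCompact_range (γ : Curve E) : IsCompact γ.range :=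
  _root_.isCompact_range γ.continuous

/-- The trace of a curve is nonempty (Aizenman–Burchard 1999, §2.1). [cite: AizenmanBurchard1999, §2.1] -/
lemma range_nonempty (γ : Curve E) : γ.range.Nonempty := Set.range_nonempty _

/-- The constant curve at a point `x` (Aizenman–Burchard 1999, §2.1). [cite: AizenmanBurchard1999, §2.1] -/
def const (x : E) : Curve E := ⟨ContinuousMap.const _ x⟩

/-- The constant curve is constant (Aizenman–Burchard 1999, §2.1). [cite: AizenmanBurchard1999, §2.1] -/
@[simp] lemma const_apply (x : E) (t : unitInterval) : const x t = x := rfl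

/-- Constant curves are fixed by reparametrisation (Aizenman–Burchard 1999, §2.1). [cite: AizenmanBurchard1999, §2.1] -/
@[simp] lemma reparam_const (x : E) (φ : unitInterval ≃o unitInterval) :
    (const x).reparam φ = const x := by
  ext t; rfl

/-- Forget the endpoints of a Mathlib `Path x y` to obtain a curve
(Aizenman–Burchard 1999, §2.1). [cite: AizenmanBurchard1999, §2.1] -/
def ofPath {x y : E} (p : Path x y) : Curve E := ⟨p.toContinuousMap⟩

/-- Pointwise formula for `Curve.ofPath` (Aizenman–Burchard 1999, §2.1). [cite: AizenmanBurchard1999, §2.1] -/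
@[simp] lemma ofPath_apply {x y : E} (p : Path x y) (t : unitInterval) : ofPath p t = p t := rfl

/-- The curve of a path `Path x y` starts at `x` (Aizenman–Burchard 1999, §2.1). [cite: AizenmanBurchard1999, §2.1] -/
@[simp] lemma source_ofPath {x y : E} (p : Path x y) : (ofPath p).source = x := p.source

/-- The curve of a path `Path x y` ends at `y` (Aizenman–Burchard 1999, §2.1). [cite: AizenmanBurchard1999, §2.1] -/
@[simp] lemma target_ofPath {x y : E} (p : Path x y) : (ofPath p).target = y := p.target

/-- Push a curve forward along a continuous map `f : C(E, F)`
(Aizenman–Burchard 1999, §2.1). [cite: AizenmanBurchard1999, §2.1] -/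
protected def map (f : C(E, F)) (γ : Curve E) : Curve F := ⟨f.comp γ.toContinuousMap⟩

/-- Pointwise formula for `Curve.map` (Aizenman–Burchard 1999, §2.1). [cite: AizenmanBurchard1999, §2.1] -/
@[simp] lemma map_apply (f : C(E, F)) (γ : Curve E) (t : unitInterval) :
    γ.map f t = f (γ t) := rfl

/-- Push-forward commutes with reparametrisation (Aizenman–Burchard 1999, §2.1). [cite: AizenmanBurchard1999, §2.1] -/
lemma map_reparam (f : C(E, F)) (γ : Curve E) (φ : unitInterval ≃o unitInterval) :
    (γ.reparam φ).map f = (γ.map f).reparam φ := by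
  ext t; rfl

/-- The trace of a pushed-forward curve is the image of the trace (Aizenman–Burchard 1999, §2.1). [cite: AizenmanBurchard1999, §2.1] -/
@[simp] lemma range_map (f : C(E, F)) (γ : Curve E) : (γ.map f).range = f '' γ.range := by
  change Set.range (f ∘ γ) = f '' Set.range γ
  exact Set.range_comp f γ

end Topological

section PseudoMetric

variable [PseudoMetricSpace E] [PseudoMetricSpace F]

/-- The reparametrisation (monotone Fréchet-type) distance between two curves:
`inf_φ sup_t dist (γ₁ t) (γ₂ (φ t))`, the infimum over increasing homeomorphisms `φ` of `[0,1]`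
of the sup distance in `C(unitInterval, E)` (Aizenman–Burchard, Duke Math. J. 99 (1999), §2.1,
eq. (2.2)). [folklore] -/
noncomputable def reparamDist (γ₁ γ₂ : Curve E) : ℝ :=
  ⨅ φ : unitInterval ≃o unitInterval, dist γ₁.toContinuousMap (γ₂.reparam φ).toContinuousMap

/-- The set of sup distances over reparametrisations is bounded below (by `0`)
(Aizenman–Burchard 1999, §2.1). [cite: AizenmanBurchard1999, §2.1] -/
lemma bddBelow_range_dist (γ₁ γ₂ : Curve E) :
    BddBelow (Set.range fun φ : unitInterval ≃o unitInterval ↦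
      dist γ₁.toContinuousMap (γ₂.reparam φ).toContinuousMap) :=
  ⟨0, by rintro _ ⟨φ, rfl⟩; exact dist_nonneg⟩

/-- The reparametrisation distance is at most the sup distance after any given
reparametrisation (Aizenman–Burchard 1999, §2.1). [cite: AizenmanBurchard1999, §2.1] -/
lemma reparamDist_le (γ₁ γ₂ : Curve E) (φ : unitInterval ≃o unitInterval) :
    reparamDist γ₁ γ₂ ≤ dist γ₁.toContinuousMap (γ₂.reparam φ).toContinuousMap :=
  ciInf_le (bddBelow_range_dist γ₁ γ₂) φ

/-- The reparametrisation distance is at most the sup distance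
(Aizenman–Burchard 1999, §2.1). [cite: AizenmanBurchard1999, §2.1] -/
lemma reparamDist_le_dist (γ₁ γ₂ : Curve E) :
    reparamDist γ₁ γ₂ ≤ dist γ₁.toContinuousMap γ₂.toContinuousMap := by
  simpa using reparamDist_le γ₁ γ₂ (OrderIso.refl _)

/-- The reparametrisation distance is nonnegative (Aizenman–Burchard 1999, §2.1). [cite: AizenmanBurchard1999, §2.1] -/
lemma reparamDist_nonneg (γ₁ γ₂ : Curve E) : 0 ≤ reparamDist γ₁ γ₂ :=
  le_ciInf fun _ ↦ dist_nonneg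

/-- The reparametrisation distance of a curve to itself vanishes
(Aizenman–Burchard 1999, §2.1). [cite: AizenmanBurchard1999, §2.1] -/
lemma reparamDist_self (γ : Curve E) : reparamDist γ γ = 0 :=
  le_antisymm (by simpa using reparamDist_le_dist γ γ) (reparamDist_nonneg γ γ)

/-- Precomposition with a reparametrisation does not increase the sup distance
(Aizenman–Burchard 1999, §2.1). [cite: AizenmanBurchard1999, §2.1] -/
lemma dist_reparam_reparam_le (γ₁ γ₂ : Curve E) (φ : unitInterval ≃o unitInterval) :
    dist (γ₁.reparam φ).toContinuousMap (γ₂.reparam φ).toContinuousMap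
      ≤ dist γ₁.toContinuousMap γ₂.toContinuousMap := by
  refine (ContinuousMap.dist_le dist_nonneg).2 fun t ↦ ?_
  exact ContinuousMap.dist_apply_le_dist (f := γ₁.toContinuousMap) (g := γ₂.toContinuousMap) (φ t)

/-- Moving a reparametrisation from one curve to the other (as its inverse) preserves the sup
distance (Aizenman–Burchard 1999, §2.1). [cite: AizenmanBurchard1999, §2.1] -/
lemma dist_reparam_symm (γ₁ γ₂ : Curve E) (φ : unitInterval ≃o unitInterval) :
    dist γ₁.toContinuousMap (γ₂.reparam φ).toContinuousMap
      = dist γ₂.toContinuousMap (γ₁.reparam φ.symm).toContinuousMap := by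
  refine le_antisymm ?_ ?_
  · have h := dist_reparam_reparam_le (γ₁.reparam φ.symm) γ₂ φ
    rw [reparam_reparam, OrderIso.self_trans_symm, reparam_refl] at h
    rwa [dist_comm γ₂.toContinuousMap]
  · have h := dist_reparam_reparam_le (γ₂.reparam φ) γ₁ φ.symm
    rw [reparam_reparam, OrderIso.symm_trans_self, reparam_refl] at h
    rwa [dist_comm γ₁.toContinuousMap]

/-- The reparametrisation distance is symmetric (Aizenman–Burchard 1999, §2.1). [cite: AizenmanBurchard1999, §2.1] -/
lemma reparamDist_comm (γ₁ γ₂ : Curve E) : reparamDist γ₁ γ₂ = reparamDist γ₂ γ₁ := by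
  refine le_antisymm (le_ciInf fun φ ↦ ?_) (le_ciInf fun φ ↦ ?_)
  · rw [dist_reparam_symm]; exact reparamDist_le _ _ _
  · rw [dist_reparam_symm]; exact reparamDist_le _ _ _

/-- The reparametrisation distance satisfies the triangle inequality
(Aizenman–Burchard 1999, §2.1). [cite: AizenmanBurchard1999, §2.1] -/
lemma reparamDist_triangle (γ₁ γ₂ γ₃ : Curve E) :
    reparamDist γ₁ γ₃ ≤ reparamDist γ₁ γ₂ + reparamDist γ₂ γ₃ := by
  -- for all φ ψ: reparamDist γ₁ γ₃ ≤ dist γ₁ (γ₂ ∘ φ) + dist γ₂ (γ₃ ∘ ψ)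
  have key : ∀ φ ψ : unitInterval ≃o unitInterval,
      reparamDist γ₁ γ₃ ≤ dist γ₁.toContinuousMap (γ₂.reparam φ).toContinuousMap
        + dist γ₂.toContinuousMap (γ₃.reparam ψ).toContinuousMap := by
    intro φ ψ
    calc reparamDist γ₁ γ₃
        ≤ dist γ₁.toContinuousMap (γ₃.reparam (φ.trans ψ)).toContinuousMap :=
          reparamDist_le _ _ _
      _ ≤ dist γ₁.toContinuousMap (γ₂.reparam φ).toContinuousMap
          + dist (γ₂.reparam φ).toContinuousMap (γ₃.reparam (φ.trans ψ)).toContinuousMap :=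
          dist_triangle _ _ _
      _ ≤ _ := by
          gcongr
          rw [← reparam_reparam]
          exact dist_reparam_reparam_le _ _ _
  have h1 : ∀ ψ : unitInterval ≃o unitInterval,
      reparamDist γ₁ γ₃ - dist γ₂.toContinuousMap (γ₃.reparam ψ).toContinuousMap
        ≤ reparamDist γ₁ γ₂ :=
    fun ψ ↦ le_ciInf fun φ ↦ by linarith [key φ ψ]
  have h2 : reparamDist γ₁ γ₃ - reparamDist γ₁ γ₂ ≤ reparamDist γ₂ γ₃ :=
    le_ciInf fun ψ ↦ by linarith [h1 ψ]
  linarith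

/-- Curves carry the reparametrisation pseudo-metric `dist := reparamDist`
(Aizenman–Burchard, Duke Math. J. 99 (1999), §2.1). Its metric quotient
`SeparationQuotient (Curve E)` is the space of curves modulo reparametrisation
(file `CurveSpace`). [folklore] -/
noncomputable instance instPseudoMetricSpace : PseudoMetricSpace (Curve E) where
  dist := reparamDist
  dist_self := reparamDist_self
  dist_comm := reparamDist_comm
  dist_triangle := reparamDist_triangle

/-- Unfolding the distance on curves (Aizenman–Burchard 1999, §2.1). [cite: AizenmanBurchard1999, §2.1] -/
lemma dist_def (γ₁ γ₂ : Curve E) : dist γ₁ γ₂ = reparamDist γ₁ γ₂ := rfl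

/-- The distance of curves is at most the sup distance of the parametrisations
(Aizenman–Burchard 1999, §2.1). [cite: AizenmanBurchard1999, §2.1] -/
lemma dist_le_dist_toContinuousMap (γ₁ γ₂ : Curve E) :
    dist γ₁ γ₂ ≤ dist γ₁.toContinuousMap γ₂.toContinuousMap :=
  reparamDist_le_dist γ₁ γ₂

/-- A curve is at distance `0` from each of its reparametrisations
(Aizenman–Burchard 1999, §2.1). [cite: AizenmanBurchard1999, §2.1] -/
@[simp] lemma dist_reparam_self (γ : Curve E) (φ : unitInterval ≃o unitInterval) :
    dist γ (γ.reparam φ) = 0 := by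
  refine le_antisymm ?_ dist_nonneg
  have h := reparamDist_le γ (γ.reparam φ) φ.symm
  rw [reparam_reparam, OrderIso.symm_trans_self, reparam_refl, dist_self] at h
  exact h

/-- A reparametrisation is at distance `0` from the original curve
(Aizenman–Burchard 1999, §2.1). [cite: AizenmanBurchard1999, §2.1] -/
@[simp] lemma dist_self_reparam (γ : Curve E) (φ : unitInterval ≃o unitInterval) :
    dist (γ.reparam φ) γ = 0 := by
  rw [dist_comm, dist_reparam_self]

/-- Pushing forward along a `K`-Lipschitz map multiplies curve distances by at most `K`
(Aizenman–Burchard 1999, §2.1). [cite: AizenmanBurchard1999, §2.1] -/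
lemma dist_map_map_le {K : NNReal} {f : C(E, F)} (hf : LipschitzWith K f) (γ₁ γ₂ : Curve E) :
    dist (γ₁.map f) (γ₂.map f) ≤ K * dist γ₁ γ₂ := by
  rw [dist_def γ₁ γ₂, reparamDist, Real.mul_iInf_of_nonneg (by positivity)]
  refine le_ciInf fun φ ↦ ?_
  refine (reparamDist_le _ _ φ).trans ?_
  rw [← map_reparam]
  refine (ContinuousMap.dist_le (by positivity)).2 fun t ↦ ?_
  exact (hf.dist_le_mul (γ₁ t) (γ₂.reparam φ t)).trans
    (mul_le_mul_of_nonneg_left (ContinuousMap.dist_apply_le_dist t) K.coe_nonneg)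

end PseudoMetric

section Measurable

variable [PseudoMetricSpace E]

/-- Curves carry the Borel σ-algebra of the reparametrisation pseudo-metric
(Aizenman–Burchard 1999, §2.1: laws of random curves are Borel measures on curve space). [cite: AizenmanBurchard1999, §2.1: laws of random curves are Borel me] -/
noncomputable instance instMeasurableSpace : MeasurableSpace (Curve E) := borel _

/-- The σ-algebra on curves is the Borel σ-algebra (Aizenman–Burchard 1999, §2.1). [cite: AizenmanBurchard1999, §2.1] -/
instance instBorelSpace : BorelSpace (Curve E) := ⟨rfl⟩

end Measurable

end Curve

end Literature.Probability.RandomPlanarGeometry
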